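import Summits.QuantumFields.YangMills.Theorems.UnitScaleTiltProp7MatrixHodgeSplit
import Summits.QuantumFields.YangMills.Theorems.UnitScaleTiltProp7PinnedConstraintSplit
import Summits.QuantumFields.YangMills.Theorems.UnitScaleTiltProp7BondAvgIterCoercivity
import Summits.QuantumFields.YangMills.Theorems.UnitScaleTiltProp7FaceFluxLineMean
import Summits.QuantumFields.YangMills.Theorems.UnitScaleTiltProp7TentPinnedBound
import Literature.MathematicalPhysics.QuantumFieldTheory.Balaban1983to89.MatrixNorms
import HarnessLib

/-!
# N7 (part 1 of 2) — THE LINEAR FLAT CORE OF STUB (P): ONE REAL COMPONENT, AND THE MATRIX BOOKKEEPING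
(route R of crux K1 «MinimiserStabilityRegPr», stmt-QuantumFields-19200; CARD-19200-V3-g11 §5 Steps 1, 4, 5 and the Step-6 lemmas;
ym3-torus seat ym-ust-20520-w3 g2, `--supports stmt-QuantumFields-19200 --as helper`).  The assembly `sum_normSq_le_curl_normSq_of_pinned`
(Steps 2, 3, 6) is part 2, `UnitScaleTiltProp7PinnedFlatCoercivity.lean`.

YM₃ on T³ is a RUNG of the ladder (R3), not the Clay problem.

WHAT IS PROVED (sorry-free, no definition; lattice factor `1`, `d = 3` where stated):
* §1 `map_grad`, `map_diverg`, `map_curl`, `map_bondAvgIter` — an `ℝ`-linear reading `π : V →ₗ[ℝ] ℝ` commutes with the lattice operators and with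
  `Q_k = LatticeFieldCalculus.bondAvgIter k` (CARD Step 1; `bondAvgIter` through `Prop7FlatCoercivity.bondAvgIter_eq_lineBlockAvg`).
* §2 ★ `sum_sq_add_grad_sq_le_of_component` — CARD Steps 4–5 for ONE real component: for a divergence-free real `B`, a real `λ` with the Dirichlet
  principle on the `k`-centres, and coarse data `r` with `L^k·(Q_kB)(c) + (λ(embIter k c₊) − λ(embIter k c₋)) = r(c)`:
  `Σ_b B² + Σ_b (∂λ)² ≤ 14·L^k·Σ_c r² + (97/8)·(L^k)²·Σ_p (∂B)²` — face-flux Pythagoras (N5 (ii)), N5 (iii), the flat engine (p452018) and N3∘N4.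
* §3 `exists_reEntry`∕`exists_imEntry` (entries as readings), `sum_normSq_le_mul_opNorm_sq` (Frobenius ≤ N·op²), `opNorm_sq_le_sum_normSq`,
  `sum_normSq_sub_le`, `sum_pbond_tgt_add_src` (both ends of all bonds = `2d` × sites), `sum_blockEnergy_le` (N6's interior block energies ≤ the
  Frobenius gradient energy), `sum_grad_sq_entry_eq_curl_sq` ∕ `sum_grad_normSq_eq_curl_normSq` (gradient energy = curl energy for `∂^*B = 0`, Frobenius).
-/

set_option autoImplicit false

noncomputable section

open scoped BigOperators Matrix.Norms.L2Operator Matrix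

namespace Summit.QuantumFields.YangMills.Theorems.Prop7PinnedFlatCoercivity

open Literature.MathematicalPhysics.QuantumFieldTheory.Balaban1983to89
open Finset LatticeFieldCalculus
open B15DeterminingSets (embIter)
open B10StarCount (sum_pbond)
open Summit.QuantumFields.YangMills.Theorems.Prop7FlatCoercivity (sum_shift sitesPerDir_zero_eq_pow_mul bondAvgIter_eq_lineBlockAvg
  bondAvgIter_eq_lineBlockAvg_real sum_sq_le_bondAvgIter_add_grad sum_grad_sq_eq_curl_add_diverg)
open Summit.QuantumFields.YangMills.Theorems.Prop7FaceFluxLineMean (sum_faceLayer_mul_coarseGrad_eq_zero sum_sq_lineMean_sub_faceMean_le)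
open Summit.QuantumFields.YangMills.Theorems.Prop7TentInterpolationT3 (sum_grad_sq_le_coarse_of_dirichlet)

variable {P : Params}

/-! ## §1 Real components: an `ℝ`-linear reading `π` commutes with `grad`, `diverg`, `curl`, `bondAvgIter` -/

section Components

variable {j : ℕ} {V : Type*} [AddCommGroup V] [Module ℝ V] (π : V →ₗ[ℝ] ℝ)

/-- `π ∘ ∂ = ∂ ∘ π` for an `ℝ`-linear reading `π` (the lattice gradient is a linear combination of values). [folklore] -/
theorem map_grad (φ : SiteField P j V) (e : PBond P j) : π (grad 1 φ e) = grad 1 (fun x => π (φ x)) e := by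
  simp only [grad, one_smul, map_sub]

/-- `π ∘ ∂^* = ∂^* ∘ π`. [folklore] -/
theorem map_diverg (A : VecField P j V) (x : Site P j) : π (diverg 1 A x) = diverg 1 (fun e => π (A e)) x := by
  simp only [diverg, one_smul, map_sum, map_sub]

/-- `π ∘ curl = curl ∘ π`. [folklore] -/
theorem map_curl (A : VecField P j V) (p : Plaq P j) : π (curl 1 A p) = curl 1 (fun e => π (A e)) p := by
  simp only [curl, one_smul, map_sub, map_add]

/-- `π ∘ Q_k = Q_k ∘ π` (through the line-block form `bondAvgIter_eq_lineBlockAvg`; standing range). [cite: Balaban1984PropagatorsI, (1.18) p.20] -/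
theorem map_bondAvgIter {k : ℕ} (hk : k ≤ P.m + P.K) (A : VecField P 0 V) (c : PBond P k) :
    π (bondAvgIter k A c) = bondAvgIter k (fun e => π (A e)) c := by
  rw [bondAvgIter_eq_lineBlockAvg hk A c, bondAvgIter_eq_lineBlockAvg hk (fun e => π (A e)) c, map_smul, map_sum]
  simp only [map_sum, smul_eq_mul]

end Components

/-! ## §2 One real component: face-flux Pythagoras, N5 (iii), the flat engine and the Dirichlet principle (Steps 4–5 of the CARD) -/

/-- **STEPS 4–5 FOR ONE REAL COMPONENT** (`d = 3`, `ℓ = L^k`).  Data: a divergence-free real bond field `B` on the finest torus, a real site function `λ`,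
coarse bond data `r` with the CONSTRAINT READ ON THE HODGE PARTS `ℓ·(Q_kB)(c) + (λ(y′₀) − λ(y₀)) = r(c)` (`y₀ = embIter k c₋`, `y′₀ = embIter k c₊`), and the
Dirichlet principle for `λ` on the `k`-centres.  Then `Σ_b B(b)² + Σ_b (∂λ)(b)² ≤ 14ℓ·Σ_c r(c)² + (97/8)ℓ²·Σ_p (∂B)(p)²`.
Proof: with the layer face flux `F(c)` (N5), `D(c) := λ(y′₀) − λ(y₀)`, `E(c) := (Q_kB)(c) − ℓ^{1−d}F(c)`, `W(c) := ℓ^{2−d}F(c)`: `D + W = r − ℓE` and `Σ_c D·W = 0`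
(`sum_faceLayer_mul_coarseGrad_eq_zero`), so `Σ D² ≤ Σ (r − ℓE)² ≤ 2Σr² + 2ℓ²ΣE²` and `Σ(ℓQ_kB)² ≤ 6Σr² + 4ℓ²ΣE²`; N5 (iii) `ℓ²ΣE² ≤ ℓ·Σ‖∇B‖²`
(`sum_sq_lineMean_sub_faceMean_le`), `Σ‖∇B‖² = Σ(∂B)²` (`sum_grad_sq_eq_curl_add_diverg`, `∂^*B = 0`); the engine `Σ B² ≤ 2ℓ³Σ(Q_kB)² + (17/8)ℓ²Σ‖∇B‖²`
(`sum_sq_le_bondAvgIter_add_grad`) and the Dirichlet bound `Σ(∂λ)² ≤ ℓ·Σ_c D²` (`Prop7TentInterpolationT3.sum_grad_sq_le_coarse_of_dirichlet`).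
[cite: Balaban1984PropagatorsI, Prop. 1.1 (1.90) p.33, (1.18)-(1.21) pp.20-21; Balaban1985Variational, Prop. 7 p.299] -/
theorem sum_sq_add_grad_sq_le_of_component (hd : P.d = 3) {k : ℕ} (hk : k ≤ P.m + P.K)
    (B : VecField P 0 ℝ) (lam : SiteField P 0 ℝ) (r : PBond P k → ℝ)
    (hdiv : diverg 1 B = 0)
    (hC1 : ∀ c : PBond P k, (P.L : ℝ) ^ k * bondAvgIter k B c + (lam (embIter k c.tgt) - lam (embIter k c.src)) = r c)
    (hmin : ∀ ψ : SiteField P 0 ℝ, (∀ x ∈ Set.range (embIter k), ψ x = lam x) →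
      ∑ b : PBond P 0, grad 1 lam b ^ 2 ≤ ∑ b : PBond P 0, grad 1 ψ b ^ 2) :
    ∑ b : PBond P 0, B b ^ 2 + ∑ b : PBond P 0, grad 1 lam b ^ 2
      ≤ 14 * (P.L : ℝ) ^ k * ∑ c : PBond P k, r c ^ 2 + (97 / 8) * ((P.L : ℝ) ^ k) ^ 2 * ∑ p : Plaq P 0, curl 1 B p ^ 2 := by
  classical
  have h := sitesPerDir_zero_eq_pow_mul (P := P) hk
  have hL1 : (1 : ℝ) ≤ P.L := by exact_mod_cast P.L_pos
  set ℓ : ℝ := (P.L : ℝ) ^ k with hℓ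
  have hℓ1 : 1 ≤ ℓ := one_le_pow₀ hL1
  have hℓ0 : 0 < ℓ := by positivity
  -- the letters
  set M : PBond P k → ℝ := fun c => bondAvgIter k B c with hM
  set FS : PBond P k → ℝ := fun c =>
    ∑ x ∈ univ.filter (fun x : Site P 0 => Site.proj k k x = c.src ∧ (x c.dir).val % P.L ^ k + 1 = P.L ^ k), B ⟨x, c.dir⟩ with hFS
  set D : PBond P k → ℝ := fun c => lam (embIter k c.tgt) - lam (embIter k c.src) with hD
  set E : PBond P k → ℝ := fun c => M c - ℓ * (ℓ ^ P.d)⁻¹ * FS c with hE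
  set W : PBond P k → ℝ := fun c => ℓ ^ 2 * (ℓ ^ P.d)⁻¹ * FS c with hW
  set G : ℝ := ∑ b : PBond P 0, ∑ ν : Fin P.d, (B ⟨b.src.shift ν, b.dir⟩ - B b) ^ 2 with hG
  have hG0 : 0 ≤ G := Finset.sum_nonneg fun _ _ => Finset.sum_nonneg fun _ _ => sq_nonneg _
  -- (a) the full gradient energy is the curl energy (`∂^*B = 0`)
  have hGcurl : G = ∑ p : Plaq P 0, curl 1 B p ^ 2 := by
    rw [hG, sum_grad_sq_eq_curl_add_diverg B]
    simp [hdiv]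
  -- (b) the flat engine
  have hEng : ∑ b : PBond P 0, B b ^ 2 ≤ 2 * ℓ ^ P.d * ∑ c : PBond P k, M c ^ 2 + (17 / 8) * ℓ ^ 2 * G :=
    sum_sq_le_bondAvgIter_add_grad hk B
  -- (c) N5 (iii): the line mean minus the face mean costs longitudinal gradients only
  have hN5 : ∑ c : PBond P k, E c ^ 2 ≤ ℓ ^ 2 * (ℓ ^ P.d)⁻¹ * G := by
    have h3 := sum_sq_lineMean_sub_faceMean_le h B
    have eM : ∀ c : PBond P k, (((P.L : ℝ) ^ k) ^ P.d * (P.L : ℝ) ^ k)⁻¹ *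
        ∑ x ∈ univ.filter (fun x : Site P 0 => Site.proj k k x = c.src), ∑ t ∈ range (P.L ^ k),
          B ⟨(fun z : Site P 0 => z.shift c.dir)^[t] x, c.dir⟩ = M c := fun c => (bondAvgIter_eq_lineBlockAvg_real hk B c).symm
    simp only [eM] at h3
    refine h3.trans (mul_le_mul_of_nonneg_left ?_ (by positivity))
    -- longitudinal ≤ all
    rw [hG, sum_pbond]
    rw [show (∑ x : Site P 0, ∑ μ : Fin P.d, ∑ ν : Fin P.d, (B ⟨(PBond.mk x μ).src.shift ν, (PBond.mk x μ).dir⟩ - B ⟨x, μ⟩) ^ 2)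
        = ∑ μ : Fin P.d, ∑ x : Site P 0, ∑ ν : Fin P.d, (B ⟨x.shift ν, μ⟩ - B ⟨x, μ⟩) ^ 2 from Finset.sum_comm]
    refine Finset.sum_le_sum fun μ _ => Finset.sum_le_sum fun x _ => ?_
    exact Finset.single_le_sum (f := fun ν : Fin P.d => (B ⟨x.shift ν, μ⟩ - B ⟨x, μ⟩) ^ 2) (fun ν _ => sq_nonneg _) (Finset.mem_univ μ)
  -- (d) orthogonality of the coarse gradient to the face flux (N5 (ii))
  have hOrth : ∑ c : PBond P k, D c * FS c = 0 :=
    sum_faceLayer_mul_coarseGrad_eq_zero h one_ne_zero hdiv (fun y => lam (embIter k y))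
  -- (e) the constraint, rearranged: `D + W = r − ℓE`
  have hDW : ∀ c, D c + W c = r c - ℓ * E c := fun c => by
    have hc := hC1 c
    simp only [hD, hW, hE, hM] at hc ⊢
    linear_combination hc
  have h2sq : ∀ a b : ℝ, (a - b) ^ 2 ≤ 2 * a ^ 2 + 2 * b ^ 2 := fun a b => by nlinarith [sq_nonneg (a + b)]
  -- (f) Pythagoras: `Σ D² ≤ Σ (r − ℓE)² ≤ 2Σr² + 2ℓ²ΣE²`
  have hP1 : ∑ c : PBond P k, D c ^ 2 ≤ 2 * ∑ c : PBond P k, r c ^ 2 + 2 * (ℓ ^ 2 * ∑ c : PBond P k, E c ^ 2) := by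
    have e : ∑ c : PBond P k, (r c - ℓ * E c) ^ 2
        = ∑ c : PBond P k, D c ^ 2 + 2 * (ℓ ^ 2 * (ℓ ^ P.d)⁻¹) * ∑ c : PBond P k, D c * FS c + ∑ c : PBond P k, W c ^ 2 := by
      rw [Finset.mul_sum, ← Finset.sum_add_distrib, ← Finset.sum_add_distrib]
      refine Finset.sum_congr rfl fun c _ => ?_
      rw [← hDW c]
      simp only [hW]
      ring
    have h1 : ∑ c : PBond P k, D c ^ 2 ≤ ∑ c : PBond P k, (r c - ℓ * E c) ^ 2 := by
      rw [e, hOrth, mul_zero, add_zero]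
      exact le_add_of_nonneg_right (Finset.sum_nonneg fun c _ => sq_nonneg _)
    refine h1.trans ?_
    rw [Finset.mul_sum, Finset.mul_sum, Finset.mul_sum, ← Finset.sum_add_distrib]
    exact Finset.sum_le_sum fun c _ => by nlinarith [h2sq (r c) (ℓ * E c)]
  -- (g) `Σ (ℓ Q_kB)² ≤ 2Σr² + 2ΣD²`
  have hP2 : ∑ c : PBond P k, (ℓ * M c) ^ 2 ≤ 2 * ∑ c : PBond P k, r c ^ 2 + 2 * ∑ c : PBond P k, D c ^ 2 := by
    rw [Finset.mul_sum, Finset.mul_sum, ← Finset.sum_add_distrib]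
    refine Finset.sum_le_sum fun c _ => ?_
    have hc : ℓ * M c = r c - D c := by
      have := hC1 c
      simp only [hM, hD]
      linarith
    rw [hc]
    exact h2sq (r c) (D c)
  -- (h) the Dirichlet principle through the tent interpolant
  have hDir : ∑ b : PBond P 0, grad 1 lam b ^ 2 ≤ ℓ * ∑ c : PBond P k, D c ^ 2 := by
    have hh := sum_grad_sq_le_coarse_of_dirichlet 1 hk lam hmin
    rw [hd, show (3 - 2 : ℕ) = 1 from rfl, pow_one] at hh
    refine hh.trans (le_of_eq ?_)
    congr 1
    refine Finset.sum_congr rfl fun c _ => ?_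
    simp only [grad, one_smul, hD]
  -- (i) bookkeeping at `d = 3`
  rw [hd] at hEng hN5
  have hN5' : ℓ ^ 2 * ∑ c : PBond P k, E c ^ 2 ≤ ℓ * G := by
    have := mul_le_mul_of_nonneg_left hN5 (sq_nonneg ℓ)
    calc ℓ ^ 2 * ∑ c : PBond P k, E c ^ 2 ≤ ℓ ^ 2 * (ℓ ^ 2 * (ℓ ^ 3)⁻¹ * G) := this
      _ = ℓ * G := by field_simp
  have hM3 : ℓ ^ 3 * ∑ c : PBond P k, M c ^ 2 = ℓ * ∑ c : PBond P k, (ℓ * M c) ^ 2 := by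
    rw [Finset.mul_sum, Finset.mul_sum]
    exact Finset.sum_congr rfl fun c _ => by ring
  -- `Σ(ℓM)² ≤ 6Σr² + 4ℓG`, `ΣD² ≤ 2Σr² + 2ℓG`
  have hDD : ∑ c : PBond P k, D c ^ 2 ≤ 2 * ∑ c : PBond P k, r c ^ 2 + 2 * (ℓ * G) := by linarith [hP1, hN5']
  have hMM : ∑ c : PBond P k, (ℓ * M c) ^ 2 ≤ 6 * ∑ c : PBond P k, r c ^ 2 + 4 * (ℓ * G) := by linarith [hP2, hDD]
  have hR0 : 0 ≤ ∑ c : PBond P k, r c ^ 2 := Finset.sum_nonneg fun _ _ => sq_nonneg _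
  have hB' : ∑ b : PBond P 0, B b ^ 2 ≤ 12 * ℓ * ∑ c : PBond P k, r c ^ 2 + (8 + 17 / 8) * ℓ ^ 2 * G := by
    have h1 : 2 * ℓ ^ 3 * ∑ c : PBond P k, M c ^ 2 = 2 * (ℓ * ∑ c : PBond P k, (ℓ * M c) ^ 2) := by rw [← hM3]; ring
    have h2 : ℓ * ∑ c : PBond P k, (ℓ * M c) ^ 2 ≤ ℓ * (6 * ∑ c : PBond P k, r c ^ 2 + 4 * (ℓ * G)) :=
      mul_le_mul_of_nonneg_left hMM hℓ0.le
    nlinarith [hEng, h1, h2]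
  have hL' : ∑ b : PBond P 0, grad 1 lam b ^ 2 ≤ 2 * ℓ * ∑ c : PBond P k, r c ^ 2 + 2 * ℓ ^ 2 * G := by
    have h2 : ℓ * ∑ c : PBond P k, D c ^ 2 ≤ ℓ * (2 * ∑ c : PBond P k, r c ^ 2 + 2 * (ℓ * G)) :=
      mul_le_mul_of_nonneg_left hDD hℓ0.le
    nlinarith [hDir, h2]
  rw [← hGcurl]
  linarith [hB', hL']

/-! ## §3 Matrix bookkeeping for Step 6: entry readings, Frobenius vs operator norm, bond/site sums -/

section MatrixBook

variable {N : ℕ}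

/-- the real part of an entry, as an `ℝ`-linear reading of `M_N(ℂ)`. [folklore] -/
theorem exists_reEntry (a b : Fin N) : ∃ π : Matrix (Fin N) (Fin N) ℂ →ₗ[ℝ] ℝ, ∀ M, π M = (M a b).re :=
  ⟨{ toFun := fun M => (M a b).re, map_add' := fun M M' => by simp, map_smul' := fun t M => by simp }, fun _ => rfl⟩

/-- the imaginary part of an entry, as an `ℝ`-linear reading of `M_N(ℂ)`. [folklore] -/
theorem exists_imEntry (a b : Fin N) : ∃ π : Matrix (Fin N) (Fin N) ℂ →ₗ[ℝ] ℝ, ∀ M, π M = (M a b).im :=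
  ⟨{ toFun := fun M => (M a b).im, map_add' := fun M M' => by simp, map_smul' := fun t M => by simp }, fun _ => rfl⟩

/-- Frobenius ≤ `N`·operator²: `Σ_{a,b} |M_{ab}|² ≤ N·‖M‖²` (each column is bounded by the operator norm). [folklore] -/
theorem sum_normSq_le_mul_opNorm_sq (M : Matrix (Fin N) (Fin N) ℂ) :
    ∑ a : Fin N, ∑ b : Fin N, Complex.normSq (M a b) ≤ N * ‖M‖ ^ 2 := by
  rw [Finset.sum_comm]
  calc ∑ b : Fin N, ∑ a : Fin N, Complex.normSq (M a b) ≤ ∑ _b : Fin N, ‖M‖ ^ 2 :=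
        Finset.sum_le_sum fun b _ => by
          refine (le_of_eq ?_).trans (MatrixNorms.sum_norm_sq_col_le_opNorm_sq M b)
          exact Finset.sum_congr rfl fun a _ => (Complex.sq_norm _).symm
    _ = N * ‖M‖ ^ 2 := by rw [Finset.sum_const, Finset.card_univ, Fintype.card_fin, nsmul_eq_mul]

/-- operator² ≤ Frobenius: `‖M‖² ≤ Σ_{a,b} |M_{ab}|²`. [folklore] -/
theorem opNorm_sq_le_sum_normSq (M : Matrix (Fin N) (Fin N) ℂ) :
    ‖M‖ ^ 2 ≤ ∑ a : Fin N, ∑ b : Fin N, Complex.normSq (M a b) := by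
  refine (MatrixNorms.opNorm_sq_le_sum_norm_sq M).trans (le_of_eq ?_)
  exact Finset.sum_congr rfl fun a _ => Finset.sum_congr rfl fun b _ => Complex.sq_norm _

/-- `|z − w|² ≤ 2|z|² + 2|w|²`, entrywise and summed. [folklore] -/
theorem sum_normSq_sub_le (M M' : Matrix (Fin N) (Fin N) ℂ) :
    ∑ a : Fin N, ∑ b : Fin N, Complex.normSq ((M - M') a b)
      ≤ 2 * ∑ a : Fin N, ∑ b : Fin N, Complex.normSq (M a b) + 2 * ∑ a : Fin N, ∑ b : Fin N, Complex.normSq (M' a b) := by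
  rw [Finset.mul_sum, Finset.mul_sum, ← Finset.sum_add_distrib]
  refine Finset.sum_le_sum fun a _ => ?_
  rw [Finset.mul_sum, Finset.mul_sum, ← Finset.sum_add_distrib]
  refine Finset.sum_le_sum fun b _ => ?_
  simp only [Matrix.sub_apply, Prop7MatrixHodgeSplit.normSq_eq_re_sq_add_im_sq, Complex.sub_re, Complex.sub_im]
  nlinarith [sq_nonneg ((M a b).re + (M' a b).re), sq_nonneg ((M a b).im + (M' a b).im)]

end MatrixBook

section LatticeBook

variable {k : ℕ}

/-- summing a site function over both ends of every positive bond counts every site `2d` times. [folklore] -/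
theorem sum_pbond_tgt_add_src (f : Site P k → ℝ) :
    ∑ c : PBond P k, (f c.tgt + f c.src) = 2 * P.d * ∑ y : Site P k, f y := by
  rw [sum_pbond, Finset.sum_comm]
  simp only [PBond.tgt]
  rw [show (∑ μ : Fin P.d, ∑ y : Site P k, (f (y.shift μ) + f y)) = ∑ _μ : Fin P.d, (2 * ∑ y : Site P k, f y) from
    Finset.sum_congr rfl fun μ _ => by rw [Finset.sum_add_distrib, sum_shift μ f]; ring]
  rw [Finset.sum_const, Finset.card_univ, Fintype.card_fin, nsmul_eq_mul]
  ring

variable {N : ℕ}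

/-- the interior block gradient energies of N6 add up to at most the full Frobenius gradient energy. [folklore] -/
theorem sum_blockEnergy_le (B : PBond P 0 → Matrix (Fin N) (Fin N) ℂ) :
    ∑ y : Site P k, ∑ μ : Fin P.d, ∑ ν : Fin P.d, ∑ x ∈ univ.filter (fun x : Site P 0 => Site.proj k k x = y),
        (if Site.proj k k (x.shift ν) = y then ‖B ⟨x.shift ν, μ⟩ - B ⟨x, μ⟩‖ ^ 2 else 0)
      ≤ ∑ x : Site P 0, ∑ μ : Fin P.d, ∑ ν : Fin P.d, ∑ a : Fin N, ∑ b : Fin N, Complex.normSq ((B ⟨x.shift ν, μ⟩ - B ⟨x, μ⟩) a b) := by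
  classical
  have step1 : ∀ (y : Site P k) (μ ν : Fin P.d) (x : Site P 0),
      (if Site.proj k k (x.shift ν) = y then ‖B ⟨x.shift ν, μ⟩ - B ⟨x, μ⟩‖ ^ 2 else 0)
        ≤ ∑ a : Fin N, ∑ b : Fin N, Complex.normSq ((B ⟨x.shift ν, μ⟩ - B ⟨x, μ⟩) a b) := by
    intro y μ ν x
    split_ifs
    · exact opNorm_sq_le_sum_normSq _
    · exact Finset.sum_nonneg fun a _ => Finset.sum_nonneg fun b _ => Complex.normSq_nonneg _
  have step2 : ∀ y : Site P k,
      (∑ μ : Fin P.d, ∑ ν : Fin P.d, ∑ x ∈ univ.filter (fun x : Site P 0 => Site.proj k k x = y),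
          ∑ a : Fin N, ∑ b : Fin N, Complex.normSq ((B ⟨x.shift ν, μ⟩ - B ⟨x, μ⟩) a b))
        = ∑ x ∈ univ.filter (fun x : Site P 0 => Site.proj k k x = y), ∑ μ : Fin P.d, ∑ ν : Fin P.d,
          ∑ a : Fin N, ∑ b : Fin N, Complex.normSq ((B ⟨x.shift ν, μ⟩ - B ⟨x, μ⟩) a b) := by
    intro y
    have e : ∀ μ : Fin P.d, (∑ ν : Fin P.d, ∑ x ∈ univ.filter (fun x : Site P 0 => Site.proj k k x = y),
          ∑ a : Fin N, ∑ b : Fin N, Complex.normSq ((B ⟨x.shift ν, μ⟩ - B ⟨x, μ⟩) a b))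
        = ∑ x ∈ univ.filter (fun x : Site P 0 => Site.proj k k x = y), ∑ ν : Fin P.d,
          ∑ a : Fin N, ∑ b : Fin N, Complex.normSq ((B ⟨x.shift ν, μ⟩ - B ⟨x, μ⟩) a b) := fun μ => by rw [Finset.sum_comm]
    simp only [e]
    rw [Finset.sum_comm]
  calc ∑ y : Site P k, ∑ μ : Fin P.d, ∑ ν : Fin P.d, ∑ x ∈ univ.filter (fun x : Site P 0 => Site.proj k k x = y),
          (if Site.proj k k (x.shift ν) = y then ‖B ⟨x.shift ν, μ⟩ - B ⟨x, μ⟩‖ ^ 2 else 0)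
      ≤ ∑ y : Site P k, ∑ μ : Fin P.d, ∑ ν : Fin P.d, ∑ x ∈ univ.filter (fun x : Site P 0 => Site.proj k k x = y),
          ∑ a : Fin N, ∑ b : Fin N, Complex.normSq ((B ⟨x.shift ν, μ⟩ - B ⟨x, μ⟩) a b) :=
        Finset.sum_le_sum fun y _ => Finset.sum_le_sum fun μ _ => Finset.sum_le_sum fun ν _ => Finset.sum_le_sum fun x _ =>
          step1 y μ ν x
    _ = ∑ y : Site P k, ∑ x ∈ univ.filter (fun x : Site P 0 => Site.proj k k x = y), ∑ μ : Fin P.d, ∑ ν : Fin P.d,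
          ∑ a : Fin N, ∑ b : Fin N, Complex.normSq ((B ⟨x.shift ν, μ⟩ - B ⟨x, μ⟩) a b) := Finset.sum_congr rfl fun y _ => step2 y
    _ = ∑ x : Site P 0, ∑ μ : Fin P.d, ∑ ν : Fin P.d, ∑ a : Fin N, ∑ b : Fin N, Complex.normSq ((B ⟨x.shift ν, μ⟩ - B ⟨x, μ⟩) a b) :=
        Finset.sum_fiberwise (Finset.univ : Finset (Site P 0)) (Site.proj k k)
          (fun x : Site P 0 => ∑ μ : Fin P.d, ∑ ν : Fin P.d, ∑ a : Fin N, ∑ b : Fin N, Complex.normSq ((B ⟨x.shift ν, μ⟩ - B ⟨x, μ⟩) a b))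

/-- one entry: the gradient energy of a real component of a divergence-free matrix bond field is its curl energy. [folklore] -/
theorem sum_grad_sq_entry_eq_curl_sq (B : PBond P 0 → Matrix (Fin N) (Fin N) ℂ) (hdiv : diverg 1 B = 0) (a b : Fin N) :
    ∑ x : Site P 0, ∑ μ : Fin P.d, ∑ ν : Fin P.d, Complex.normSq ((B ⟨x.shift ν, μ⟩ - B ⟨x, μ⟩) a b)
      = ∑ p : Plaq P 0, Complex.normSq ((curl 1 B p) a b) := by
  obtain ⟨πr, hπr⟩ := exists_reEntry (N := N) a b
  obtain ⟨πi, hπi⟩ := exists_imEntry (N := N) a b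
  have hdR : ∀ x, diverg 1 (fun e => πr (B e)) x = 0 := fun x => by
    rw [← map_diverg πr B x, congrFun hdiv x, Pi.zero_apply, map_zero]
  have hdI : ∀ x, diverg 1 (fun e => πi (B e)) x = 0 := fun x => by
    rw [← map_diverg πi B x, congrFun hdiv x, Pi.zero_apply, map_zero]
  have hcR : ∀ p, curl 1 (fun e => πr (B e)) p = πr (curl 1 B p) := fun p => (map_curl πr B p).symm
  have hcI : ∀ p, curl 1 (fun e => πi (B e)) p = πi (curl 1 B p) := fun p => (map_curl πi B p).symm
  have hR := sum_grad_sq_eq_curl_add_diverg (P := P) (i := 0) (fun e => πr (B e))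
  have hI := sum_grad_sq_eq_curl_add_diverg (P := P) (i := 0) (fun e => πi (B e))
  rw [sum_pbond] at hR hI
  simp only [hdR, hdI, hcR, hcI, ne_eq, OfNat.ofNat_ne_zero, not_false_eq_true, zero_pow, Finset.sum_const_zero,
    add_zero] at hR hI
  simp only [hπr, hπi] at hR hI
  simp only [Prop7MatrixHodgeSplit.normSq_eq_re_sq_add_im_sq, Matrix.sub_apply, Complex.sub_re, Complex.sub_im, Finset.sum_add_distrib]
  rw [hR, hI]

/-- the Frobenius gradient energy of a divergence-free matrix bond field is its Frobenius curl energy (entrywise `sum_grad_sq_eq_curl_add_diverg`). [folklore] -/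
theorem sum_grad_normSq_eq_curl_normSq (B : PBond P 0 → Matrix (Fin N) (Fin N) ℂ) (hdiv : diverg 1 B = 0) :
    ∑ x : Site P 0, ∑ μ : Fin P.d, ∑ ν : Fin P.d, ∑ a : Fin N, ∑ b : Fin N, Complex.normSq ((B ⟨x.shift ν, μ⟩ - B ⟨x, μ⟩) a b)
      = ∑ p : Plaq P 0, ∑ a : Fin N, ∑ b : Fin N, Complex.normSq ((curl 1 B p) a b) := by
  -- entries outside on both sides
  have eL : (∑ x : Site P 0, ∑ μ : Fin P.d, ∑ ν : Fin P.d, ∑ a : Fin N, ∑ b : Fin N, Complex.normSq ((B ⟨x.shift ν, μ⟩ - B ⟨x, μ⟩) a b))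
      = ∑ a : Fin N, ∑ b : Fin N, ∑ x : Site P 0, ∑ μ : Fin P.d, ∑ ν : Fin P.d, Complex.normSq ((B ⟨x.shift ν, μ⟩ - B ⟨x, μ⟩) a b) := by
    have e1 : ∀ (x : Site P 0) (μ : Fin P.d),
        (∑ ν : Fin P.d, ∑ a : Fin N, ∑ b : Fin N, Complex.normSq ((B ⟨x.shift ν, μ⟩ - B ⟨x, μ⟩) a b))
          = ∑ a : Fin N, ∑ b : Fin N, ∑ ν : Fin P.d, Complex.normSq ((B ⟨x.shift ν, μ⟩ - B ⟨x, μ⟩) a b) := by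
      intro x μ
      rw [Finset.sum_comm]
      refine Finset.sum_congr rfl fun a _ => ?_
      rw [Finset.sum_comm]
    have e2 : ∀ x : Site P 0,
        (∑ μ : Fin P.d, ∑ a : Fin N, ∑ b : Fin N, ∑ ν : Fin P.d, Complex.normSq ((B ⟨x.shift ν, μ⟩ - B ⟨x, μ⟩) a b))
          = ∑ a : Fin N, ∑ b : Fin N, ∑ μ : Fin P.d, ∑ ν : Fin P.d, Complex.normSq ((B ⟨x.shift ν, μ⟩ - B ⟨x, μ⟩) a b) := by
      intro x
      rw [Finset.sum_comm]
      refine Finset.sum_congr rfl fun a _ => ?_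
      rw [Finset.sum_comm]
    simp only [e1, e2]
    rw [Finset.sum_comm]
    refine Finset.sum_congr rfl fun a _ => ?_
    rw [Finset.sum_comm]
  have eR : (∑ p : Plaq P 0, ∑ a : Fin N, ∑ b : Fin N, Complex.normSq ((curl 1 B p) a b))
      = ∑ a : Fin N, ∑ b : Fin N, ∑ p : Plaq P 0, Complex.normSq ((curl 1 B p) a b) := by
    rw [Finset.sum_comm]
    refine Finset.sum_congr rfl fun a _ => ?_
    rw [Finset.sum_comm]
  rw [eL, eR]
  exact Finset.sum_congr rfl fun a _ => Finset.sum_congr rfl fun b _ => sum_grad_sq_entry_eq_curl_sq B hdiv a b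

end LatticeBook

end Summit.QuantumFields.YangMills.Theorems.Prop7PinnedFlatCoercivity

end
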